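import Literature.Probability.Percolation.SlabRSWCase3Separation
import HarnessLib

/-!
# Newman–Tassion–Wu 2017, Theorem 3.14, Case 3 / Lemma 3.16 — the crossing step: the path from `Y`
# to `γ'` and the mirror path from `Y'` to `γ` meet

Topic: `Literature/Probability/Percolation`. In the proof of Lemma 3.16 (arXiv:1512.09107, p. 16) the
gluing lemma is applied to an open path from `Y` to (a neighbourhood of) `γ'` and an open path from
`Y'` to `γ`, which must cross ("the projection … of any path from `A` to `B` in `S` intersects the
projection of any path from `C` to `D`", the hypothesis of Theorem 3.6). This file sets up the
gluing datum of that step in the reflected frame of `SlabRSWTheorem314Case2/3.lean` and proves the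
crossing:

* `mirrorGlue n hn Γ ρ₂` — the gluing datum `Q₁ = (S₁ = R' ∖ 𝒩(Γ,ρ₂) ⊆ R₁ = R', A₁ = C,
  B₁ = τΓ̄-columns, C₁ = τC)`, `τ : x ↦ 14n - x`, for a path `Γ` (the realised `Γ_min` of Case 3);
  its event `A₁ ⟷^{S₁} B₁` is the target event of `evOff_subset_toMirror`;
* **`mem_evNear_mirrorGlue`** — a lattice configuration in `{C ⟷^{R'∖𝒩(Γ,ρ₂)} τΓ}` and in the
  mirror event `{τC ⟷^{τ(R'∖𝒩(Γ,ρ₂))} Γ}` lies in `Q₁.evNear 0`: the minimal path `Γ₁` of the first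
  event and any open path of the second share a column (planar crossing in `[-2,14n+2]×[-2,13n-1]`
  of the two walks extended along `τΓ`, `Γ` and side stubs at distinct heights).

With Harris–FKG (the two events are increasing and `τ`-symmetric) and
`GlueData.real_evAB_inter_evNear_le_of_gadgets` this reduces Lemma 3.16 (hence `(H316)` of
`thm314_hCase3_of`) to a supply of local modifications (`GadgetSpec`) for the datum `Q₁`, whose
domain `S₁ = R' ∖ 𝒩(Γ, ρ₂)` is not a rectangle (NTW: "`K_□` is regular enough to apply Theorem 3.6",
Remark 2 after Theorem 3.7).

## Sources

* C. M. Newman, V. Tassion, W. Wu, *Critical percolation and the minimal spanning tree in slabs*,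
  Comm. Pure Appl. Math. 70 (2017), arXiv:1512.09107: §3.5, Lemma 3.16 and its proof; Theorem 3.6
  (hypothesis); proof of Theorem 3.14, Case 3 [NewmanTassionWu2017].
-/

noncomputable section

namespace Literature.Probability.Percolation

open MeasureTheory LatticeModels SimpleGraph

namespace NTW17

variable {k : ℕ}

/-! ## The gluing datum of Lemma 3.16 in the reflected frame -/

/-- **The gluing datum of Lemma 3.16** (reflected frame, realised `Γ`): `S₁ = R' ∖ 𝒩(Γ, ρ₂)`,
`R₁ = R' = [0,14n]×[0,13n-1]`, `A₁ = C = {0}×[5n,13n-1]`, `B₁ =` the columns of `τΓ`,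
`C₁ = τC = {14n}×[5n,13n-1]`, `τ : x ↦ 14n - x`. [cite: NewmanTassionWu2017, §3.5 (Lemma 3.16, the sets K(γ), A, Y, Y′)] -/
def mirrorGlue (n : ℕ) (hn : 1 ≤ n) (Γ : List (slab 3 k)) (ρ₂ : ℕ) : GlueData where
  S := (case2Setup n hn).R \ {z | Near k Γ ρ₂ z}
  R := (case2Setup n hn).R
  A := (case2Setup n hn).C
  B := {z | ∃ g ∈ Γ, z = planarReflect (14 * (n : ℤ)) (planar k g)}
  C := planarReflect (14 * (n : ℤ)) '' (case2Setup n hn).C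
  hSR := Set.sdiff_subset
  hSfin := (boxR_finite _ _ _ _).subset Set.sdiff_subset
  hRfin := boxR_finite _ _ _ _

section Cross

variable {n ρ₂ : ℕ} (hn : 1 ≤ n) {ω ω' : BondConfig (slab 3 k)}

/-- `τ R' = R'`. [cite: NewmanTassionWu2017, §3.5 (R is symmetric)] -/
theorem image_reflect14_R (n : ℕ) :
    planarReflect (14 * (n : ℤ)) '' boxR 0 (14 * n) 0 (13 * n - 1) = boxR 0 (14 * n) 0 (13 * n - 1) := by
  rw [image_planarReflect_eq]
  ext z
  simp only [Set.mem_setOf_eq, mem_boxR_iff]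
  omega

/-- The projection of a prefix `p ++ [g]` of an open path is a planar walk from the path's first
cell to the cell of `g`. [cite: NewmanTassionWu2017, §3.2 (Theorem 3.6, projections of paths)] -/
theorem prefix_facts (hω : ω ⊆ (slabGraph 3 k).edgeSet) {S X Y : Set (slab 3 k)} {Γ : List (slab 3 k)}
    (hΓ : IsOSAP k ω S X Y Γ) {p s : List (slab 3 k)} {g : slab 3 k} (hps : Γ = p ++ g :: s) :
    IsPlanarWalk ((p ++ [g]).map (planar k)) ∧ (p ++ [g] ≠ []) ∧
      ((p ++ [g]).map (planar k)).head? = some (planar k (Γ.head hΓ.ne_nil)) ∧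
      ((p ++ [g]).map (planar k)).getLast? = some (planar k g) ∧
      (∀ x ∈ p ++ [g], x ∈ Γ) ∧ (Γ.getLast hΓ.ne_nil ∈ p ++ [g] → s = []) := by
  have hsplit : Γ = (p ++ [g]) ++ s := by rw [hps]; simp
  have hch : (p ++ [g]).IsChain (fun a b => s(a, b) ∈ ω ∧ a ≠ b) := by
    have hc := hΓ.chain
    rw [hsplit] at hc
    exact (List.isChain_append.1 hc).1
  refine ⟨isPlanarWalk_map_planar hω hch, by simp, ?_, ?_, ?_, ?_⟩
  · rw [List.head?_map]
    have : Γ.head? = (p ++ [g]).head? := by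
      rw [hsplit, List.head?_append, List.head?_eq_some_head (show p ++ [g] ≠ [] by simp), Option.some_or]
    rw [← this, List.head?_eq_some_head hΓ.ne_nil, Option.map_some]
  · rw [List.getLast?_map, List.getLast?_concat]; rfl
  · intro x hx
    rw [hsplit]
    exact List.mem_append_left _ hx
  · intro hlast
    by_contra hs
    have hnd := hΓ.nodup
    rw [hsplit, List.nodup_append] at hnd
    have hmem : Γ.getLast hΓ.ne_nil ∈ s := by
      have : Γ.getLast hΓ.ne_nil = ((p ++ [g]) ++ s).getLast (by simp) := List.getLast_congr _ _ hsplit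
      rw [this, List.getLast_append_of_ne_nil _ hs]
      exact List.getLast_mem hs
    exact hnd.2.2 _ hlast _ hmem rfl

/-- **The crossing step of Lemma 3.16** (reflected frame). Let `ω` be a lattice configuration with
`A ⟷^{S'} B`, `Γ = Q.γ ω`, `Q₁ = mirrorGlue n Γ ρ₂`. A lattice configuration `ω'` with
`C ⟷^{R' ∖ 𝒩(Γ,ρ₂)} τΓ` (`Q₁.evAB`) and `τC ⟷^{τ(R' ∖ 𝒩(Γ,ρ₂))} Γ` is in `Q₁.evNear 0`: an open path
of the second event meets a column of the minimal path `Γ₁` of the first.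
[cite: NewmanTassionWu2017, §3.5 (proof of Lemma 3.16, application of Theorem 3.6: the two paths cross)] -/
theorem mem_evNear_mirrorGlue (hω : ω ⊆ (slabGraph 3 k).edgeSet) (hA : ω ∈ (case2Setup n hn).Q.evAB k)
    (hω' : ω' ⊆ (slabGraph 3 k).edgeSet)
    (h₁ : ω' ∈ (mirrorGlue n hn ((case2Setup n hn).Q.γ k ω) ρ₂).evAB k)
    (h₂ : ω' ∈ slabConn k
      (planarReflect (14 * (n : ℤ)) '' ((case2Setup n hn).R \ {z | Near k ((case2Setup n hn).Q.γ k ω) ρ₂ z}))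
      (planarReflect (14 * (n : ℤ)) '' (case2Setup n hn).C)
      (planarReflect (14 * (n : ℤ)) '' {z | ∃ g ∈ (case2Setup n hn).Q.γ k ω, z = planarReflect (14 * (n : ℤ)) (planar k g)})) :
    ω' ∈ (mirrorGlue n hn ((case2Setup n hn).Q.γ k ω) ρ₂).evNear k 0 := by
  set E := case2Setup n hn with hE
  set Γ := E.Q.γ k ω with hΓdef
  set τ := planarReflect (14 * (n : ℤ)) with hτ
  set Q₁ := mirrorGlue n hn Γ ρ₂ with hQ₁
  obtain ⟨hΓO, -⟩ := E.Q.γ_spec hA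
  -- `Γ` in coordinates
  have hΓS : ∀ g ∈ Γ, planar k g ∈ E.S := fun g hg => hΓO.subset g hg
  have hΓS' : ∀ g ∈ Γ, 0 ≤ (planar k g).1 ∧ (planar k g).1 ≤ 7 * n ∧ 0 ≤ (planar k g).2 ∧ (planar k g).2 ≤ 8 * n - 1 := by
    intro g hg
    have := hΓS g hg
    rw [show E.S = boxR 0 (7 * n) 0 (8 * n - 1) from rfl, mem_boxR_iff] at this
    exact this
  have haA : planar k (Γ.head hΓO.ne_nil) ∈ E.A := hΓO.head_mem hΓO.ne_nil
  rw [show E.A = sideSeg 0 0 (4 * n - 1) from rfl, sideSeg, Set.mem_setOf_eq] at haA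
  set a₂ : ℤ := (planar k (Γ.head hΓO.ne_nil)).2 with ha₂
  have hpa : planar k (Γ.head hΓO.ne_nil) = (0, a₂) := Prod.ext haA.1 rfl
  have hlastB : ∀ u ∈ Γ, (planar k u).1 = 7 * n → u = Γ.getLast hΓO.ne_nil := by
    intro u hu hu7
    refine eq_getLast_of_mem_B hA hu ?_
    show planar k u ∈ E.B
    rw [ExtSetup.mem_B_iff]
    exact ⟨hΓS u hu, hu7⟩
  have hτinvol : ∀ z : ℤ × ℤ, τ (τ z) = z := fun z => by
    rw [hτ, planarReflect_apply, planarReflect_apply]; ext <;> simp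
  -- `Γ₁`, the minimal path of `Q₁`
  obtain ⟨hΓ₁O, -⟩ := Q₁.γ_spec h₁
  set Γ₁ := Q₁.γ k ω' with hΓ₁def
  have hΓ₁R : ∀ u ∈ Γ₁, planar k u ∈ E.R ∧ ¬Near k Γ ρ₂ (planar k u) := fun u hu => hΓ₁O.subset u hu
  have hΓ₁R' : ∀ u ∈ Γ₁, 0 ≤ (planar k u).1 ∧ (planar k u).1 ≤ 14 * n ∧ 0 ≤ (planar k u).2 ∧
      (planar k u).2 ≤ 13 * n - 1 := by
    intro u hu
    have := (hΓ₁R u hu).1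
    rw [show E.R = boxR 0 (14 * n) 0 (13 * n - 1) from rfl, mem_boxR_iff] at this
    exact this
  have hc₁ : planar k (Γ₁.head hΓ₁O.ne_nil) ∈ E.C := hΓ₁O.head_mem hΓ₁O.ne_nil
  rw [show E.C = sideSeg 0 (5 * n) (13 * n - 1) from rfl, sideSeg, Set.mem_setOf_eq] at hc₁
  set h₁ : ℤ := (planar k (Γ₁.head hΓ₁O.ne_nil)).2 with hh₁
  have hpc₁ : planar k (Γ₁.head hΓ₁O.ne_nil) = (0, h₁) := Prod.ext hc₁.1 rfl
  obtain ⟨g, hg, ht₁⟩ : ∃ g ∈ Γ, planar k (Γ₁.getLast hΓ₁O.ne_nil) = τ (planar k g) :=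
    hΓ₁O.last_mem hΓ₁O.ne_nil
  have ht₁N : ¬Near k Γ ρ₂ (planar k (Γ₁.getLast hΓ₁O.ne_nil)) := (hΓ₁R _ (List.getLast_mem _)).2
  -- `P₂`, an open path of the mirror event
  obtain ⟨P₂, hP₂⟩ := (mem_slabConn_iff_exists_isOSAP ω' _ _ _).1 h₂
  have hP₂R : ∀ q ∈ P₂, ∃ w ∈ E.R, ¬Near k Γ ρ₂ w ∧ planar k q = τ w := by
    intro q hq
    obtain ⟨w, ⟨hwR, hwN⟩, hw⟩ := hP₂.subset q hq
    exact ⟨w, hwR, hwN, hw.symm⟩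
  have hP₂R' : ∀ q ∈ P₂, 0 ≤ (planar k q).1 ∧ (planar k q).1 ≤ 14 * n ∧ 0 ≤ (planar k q).2 ∧
      (planar k q).2 ≤ 13 * n - 1 := by
    intro q hq
    obtain ⟨w, hwR, -, hqw⟩ := hP₂R q hq
    rw [show E.R = boxR 0 (14 * n) 0 (13 * n - 1) from rfl, mem_boxR_iff] at hwR
    rw [hqw, hτ, planarReflect_apply]
    simp only
    omega
  obtain ⟨w₂, hw₂C, hc₂⟩ : ∃ w ∈ E.C, τ w = planar k (P₂.head hP₂.ne_nil) := hP₂.head_mem hP₂.ne_nil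
  rw [show E.C = sideSeg 0 (5 * n) (13 * n - 1) from rfl, sideSeg, Set.mem_setOf_eq] at hw₂C
  set h₂ : ℤ := w₂.2 with hh₂
  have hpc₂ : planar k (P₂.head hP₂.ne_nil) = ((14 : ℤ) * n, h₂) := by
    rw [← hc₂, hτ, planarReflect_apply, hw₂C.1]; simp [hh₂]
  obtain ⟨g', hg', ht₂⟩ : ∃ g' ∈ Γ, planar k (P₂.getLast hP₂.ne_nil) = planar k g' := by
    obtain ⟨w, ⟨g', hg', hw⟩, hw'⟩ := hP₂.last_mem hP₂.ne_nil
    exact ⟨g', hg', by rw [← hw', hw, hτinvol]⟩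
  -- the prefixes of `Γ` up to `g` and `g'`
  obtain ⟨p, s, hps⟩ := List.append_of_mem hg
  obtain ⟨p', s', hps'⟩ := List.append_of_mem hg'
  obtain ⟨hw1, hne1, hhd1, hlt1, hmem1, hlast1⟩ := prefix_facts hω hΓO hps
  obtain ⟨hw2, hne2, hhd2, hlt2, hmem2, hlast2⟩ := prefix_facts hω hΓO hps'
  set pre₁ : List (ℤ × ℤ) := (p ++ [g]).map (planar k) with hpre₁
  set pre₂ : List (ℤ × ℤ) := (p' ++ [g']).map (planar k) with hpre₂
  have hpre₁ne : pre₁ ≠ [] := by simp [hpre₁]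
  have hpre₂ne : pre₂ ≠ [] := by simp [hpre₂]
  rw [hpa] at hhd1 hhd2
  -- the projections of `Γ₁` and `P₂`
  set pΓ₁ : List (ℤ × ℤ) := Γ₁.map (planar k) with hpΓ₁
  set pP₂ : List (ℤ × ℤ) := P₂.map (planar k) with hpP₂
  have hpΓ₁ne : pΓ₁ ≠ [] := by simpa [hpΓ₁] using hΓ₁O.ne_nil
  have hpP₂ne : pP₂ ≠ [] := by simpa [hpP₂] using hP₂.ne_nil
  have hwΓ₁ : IsPlanarWalk pΓ₁ := isPlanarWalk_map_planar hω' hΓ₁O.chain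
  have hwP₂ : IsPlanarWalk pP₂ := isPlanarWalk_map_planar hω' hP₂.chain
  have hpΓ₁hd : pΓ₁.head? = some ((0 : ℤ), h₁) := by
    rw [hpΓ₁, List.head?_map, List.head?_eq_some_head hΓ₁O.ne_nil, Option.map_some, hpc₁]
  have hpΓ₁lt : pΓ₁.getLast? = some (τ (planar k g)) := by
    rw [hpΓ₁, List.getLast?_map, List.getLast?_eq_some_getLast hΓ₁O.ne_nil, Option.map_some, ht₁]
  have hpP₂hd : pP₂.head? = some ((14 : ℤ) * n, h₂) := by
    rw [hpP₂, List.head?_map, List.head?_eq_some_head hP₂.ne_nil, Option.map_some, hpc₂]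
  have hpP₂lt : pP₂.getLast? = some (planar k g') := by
    rw [hpP₂, List.getLast?_map, List.getLast?_eq_some_getLast hP₂.ne_nil, Option.map_some, ht₂]
  -- the LR walk
  set LR : List (ℤ × ℤ) := (-2, h₁) :: (-1, h₁) ::
    (pΓ₁ ++ ((pre₁.map τ).reverse ++ [(14 * (n : ℤ) + 1, a₂), (14 * (n : ℤ) + 2, a₂)])) with hLR
  have hLRne : LR ≠ [] := List.cons_ne_nil _ _
  have hwLR : IsPlanarWalk LR := by
    rw [hLR]
    have h3 : IsPlanarWalk ((pre₁.map τ).reverse ++ [(14 * (n : ℤ) + 1, a₂), (14 * (n : ℤ) + 2, a₂)]) := by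
      refine isPlanarWalk_append (isPlanarWalk_reverse (hw1.map (planarAdj_planarReflect _))) ?_ fun x hx y hy => ?_
      · refine List.IsChain.cons_cons (Or.inr ?_) (List.IsChain.singleton _)
        left; left
        refine Prod.ext ?_ ?_ <;> simp only [Prod.fst_add, Prod.snd_add] <;> omega
      · rw [List.getLast?_reverse, List.head?_map, hhd1, Option.map_some, Option.mem_def, Option.some.injEq] at hx
        rw [List.head?_cons, Option.mem_def, Option.some.injEq] at hy
        subst hx; subst hy
        right; left; left
        rw [hτ, planarReflect_apply]; ext <;> simp
    have h2 : IsPlanarWalk (pΓ₁ ++ ((pre₁.map τ).reverse ++ [(14 * (n : ℤ) + 1, a₂), (14 * (n : ℤ) + 2, a₂)])) := by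
      refine isPlanarWalk_append hwΓ₁ h3 fun x hx y hy => ?_
      rw [hpΓ₁lt, Option.mem_def, Option.some.injEq] at hx
      rw [List.head?_append, List.head?_reverse, List.getLast?_map, hlt1, Option.map_some, Option.some_or,
        Option.mem_def, Option.some.injEq] at hy
      left; rw [← hx, ← hy]
    refine List.IsChain.cons_cons (Or.inr ?_) (List.IsChain.cons_of_ne_nil (by simp [hpΓ₁ne]) h2 ?_)
    · left; left; ext <;> simp
    · have : (pΓ₁ ++ ((pre₁.map τ).reverse ++ [(14 * (n : ℤ) + 1, a₂), (14 * (n : ℤ) + 2, a₂)])).head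
          (by simp [hpΓ₁ne]) = (0, h₁) := by
        apply Option.some.inj
        rw [← List.head?_eq_some_head, List.head?_append, hpΓ₁hd, Option.some_or]
      rw [this]
      right; left; left; ext <;> simp
  -- the TB walk
  set m₂ : ℕ := (13 * (n : ℤ) - 1 - h₂).toNat with hm₂
  have hm₂c : h₂ + m₂ = 13 * n - 1 := by rw [hm₂, Int.toNat_of_nonneg (by omega)]; ring
  set m₃ : ℕ := (a₂ + 2).toNat with hm₃
  have hm₃c : (-2 : ℤ) + m₃ = a₂ := by rw [hm₃, Int.toNat_of_nonneg (by omega)]; ring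
  set TB : List (ℤ × ℤ) := colWalk (14 * (n : ℤ) + 2) h₂ m₂ ++ ((14 * (n : ℤ) + 1, h₂) ::
    (pP₂ ++ (pre₂.reverse ++ ((-1, a₂) :: colWalk (-2) (-2) m₃)))) with hTB
  have hTBne : TB ≠ [] := by simp [hTB, colWalk_ne_nil]
  have hwTB : IsPlanarWalk TB := by
    rw [hTB]
    have h4 : IsPlanarWalk (pre₂.reverse ++ ((-1, a₂) :: colWalk (-2) (-2) m₃)) := by
      refine isPlanarWalk_append (isPlanarWalk_reverse hw2) ?_ fun x hx y hy => ?_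
      · refine List.IsChain.cons_of_ne_nil (colWalk_ne_nil _ _ _) (isPlanarWalk_colWalk _ _ _) (Or.inr ?_)
        rw [head_colWalk, hm₃c]
        left; right; ext <;> simp
      · rw [List.getLast?_reverse, hhd2, Option.mem_def, Option.some.injEq] at hx
        rw [List.head?_cons, Option.mem_def, Option.some.injEq] at hy
        subst hx; subst hy
        right; left; right; ext <;> simp
    have h3 : IsPlanarWalk (pP₂ ++ (pre₂.reverse ++ ((-1, a₂) :: colWalk (-2) (-2) m₃))) := by
      refine isPlanarWalk_append hwP₂ h4 fun x hx y hy => ?_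
      rw [hpP₂lt, Option.mem_def, Option.some.injEq] at hx
      rw [List.head?_append, List.head?_reverse, hlt2, Option.some_or, Option.mem_def, Option.some.injEq] at hy
      left; rw [← hx, ← hy]
    have h2 : IsPlanarWalk (((14 * (n : ℤ) + 1, h₂) :: (pP₂ ++ (pre₂.reverse ++ ((-1, a₂) :: colWalk (-2) (-2) m₃))))) := by
      refine List.IsChain.cons_of_ne_nil (by simp [hpP₂ne]) h3 (Or.inr ?_)
      have : (pP₂ ++ (pre₂.reverse ++ ((-1, a₂) :: colWalk (-2) (-2) m₃))).head (by simp [hpP₂ne]) = ((14 : ℤ) * n, h₂) := by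
        apply Option.some.inj
        rw [← List.head?_eq_some_head, List.head?_append, hpP₂hd, Option.some_or]
      rw [this]
      left; right; ext <;> simp
    refine isPlanarWalk_append (isPlanarWalk_colWalk _ _ _) h2 fun x hx y hy => ?_
    rw [getLast?_colWalk, Option.mem_def, Option.some.injEq] at hx
    rw [List.head?_cons, Option.mem_def, Option.some.injEq] at hy
    subst hx; subst hy
    right; left; right
    refine Prod.ext ?_ ?_ <;> simp only [Prod.fst_add, Prod.snd_add] <;> omega
  -- inside the big rectangle
  have hpre₁S : ∀ v ∈ pre₁, 0 ≤ v.1 ∧ v.1 ≤ 7 * n ∧ 0 ≤ v.2 ∧ v.2 ≤ 8 * n - 1 := by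
    intro v hv
    obtain ⟨u, hu, rfl⟩ := List.mem_map.1 hv
    exact hΓS' u (hmem1 u hu)
  have hpre₂S : ∀ v ∈ pre₂, 0 ≤ v.1 ∧ v.1 ≤ 7 * n ∧ 0 ≤ v.2 ∧ v.2 ≤ 8 * n - 1 := by
    intro v hv
    obtain ⟨u, hu, rfl⟩ := List.mem_map.1 hv
    exact hΓS' u (hmem2 u hu)
  have hpΓ₁S : ∀ v ∈ pΓ₁, 0 ≤ v.1 ∧ v.1 ≤ 14 * n ∧ 0 ≤ v.2 ∧ v.2 ≤ 13 * n - 1 := by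
    intro v hv
    obtain ⟨u, hu, rfl⟩ := List.mem_map.1 hv
    exact hΓ₁R' u hu
  have hpP₂S : ∀ v ∈ pP₂, 0 ≤ v.1 ∧ v.1 ≤ 14 * n ∧ 0 ≤ v.2 ∧ v.2 ≤ 13 * n - 1 := by
    intro v hv
    obtain ⟨u, hu, rfl⟩ := List.mem_map.1 hv
    exact hP₂R' u hu
  have hτpre₁S : ∀ v ∈ pre₁.map τ, 7 * n ≤ v.1 ∧ v.1 ≤ 14 * n ∧ 0 ≤ v.2 ∧ v.2 ≤ 8 * n - 1 := by
    intro v hv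
    obtain ⟨u, hu, rfl⟩ := List.mem_map.1 hv
    have := hpre₁S u hu
    rw [hτ, planarReflect_apply]; simp only; omega
  have hLRbox : ∀ v ∈ LR, v ∈ boxR (-2) (14 * n + 2) (-2) (13 * n - 1) := by
    intro v hv
    rw [mem_boxR_iff]
    rw [hLR, List.mem_cons, List.mem_cons, List.mem_append, List.mem_append, List.mem_reverse] at hv
    rcases hv with rfl | rfl | hv | hv | hv
    · simp only; omega
    · simp only; omega
    · have := hpΓ₁S v hv; omega
    · have := hτpre₁S v hv; omega
    · simp only [List.mem_cons, List.not_mem_nil, or_false] at hv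
      rcases hv with rfl | rfl <;> simp only <;> omega
  have hTBbox : ∀ v ∈ TB, v ∈ boxR (-2) (14 * n + 2) (-2) (13 * n - 1) := by
    intro v hv
    rw [mem_boxR_iff]
    rw [hTB, List.mem_append, mem_colWalk_iff, List.mem_cons, List.mem_append, List.mem_append,
      List.mem_reverse, List.mem_cons, mem_colWalk_iff] at hv
    rcases hv with ⟨e1, e2, e3⟩ | rfl | hv | hv | rfl | ⟨e1, e2, e3⟩
    · omega
    · simp only; omega
    · have := hpP₂S v hv; omega
    · have := hpre₂S v hv; omega
    · simp only; omega
    · omega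
  -- endpoints
  have hLRhead : (LR.head hLRne).1 = -2 := by simp [hLR]
  have hLRlast : (LR.getLast hLRne).1 = 14 * n + 2 := by
    have e : LR = ((-2, h₁) :: (-1, h₁) :: (pΓ₁ ++ ((pre₁.map τ).reverse ++ [(14 * (n : ℤ) + 1, a₂)]))) ++
        [(14 * (n : ℤ) + 2, a₂)] := by simp [hLR]
    rw [List.getLast_congr hLRne (by simp) e, List.getLast_append_of_ne_nil _ (List.cons_ne_nil _ _),
      List.getLast_singleton]
  have hTBhead : (TB.head hTBne).2 = 13 * n - 1 := by
    have : TB.head hTBne = ((14 : ℤ) * n + 2, h₂ + m₂) := by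
      apply Option.some.inj
      rw [← List.head?_eq_some_head hTBne, hTB, List.head?_append, head?_colWalk, Option.some_or]
    rw [this]; exact hm₂c
  have hTBlast : (TB.getLast hTBne).2 = -2 := by
    have e : TB = (colWalk (14 * (n : ℤ) + 2) h₂ m₂ ++ ((14 * (n : ℤ) + 1, h₂) ::
        (pP₂ ++ (pre₂.reverse ++ [(-1, a₂)])))) ++ colWalk (-2) (-2) m₃ := by simp [hTB]
    rw [List.getLast_congr hTBne (by simp [colWalk_ne_nil]) e,
      List.getLast_append_of_ne_nil _ (colWalk_ne_nil _ _ _), getLast_colWalk]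
  -- the crossing
  obtain ⟨v, hvLR, hvTB⟩ := planarCrossing_rect' (a := -2) (b := 14 * (n : ℤ) + 2) (c := -2)
    (d := 13 * (n : ℤ) - 1) (A := {v | v.1 = -2}) (B := {v | v.1 = 14 * (n : ℤ) + 2})
    (C := {v | v.2 = 13 * (n : ℤ) - 1}) (D := {v | v.2 = -2}) (fun _ h => h) (fun _ h => h) (fun _ h => h)
    (fun _ h => h) LR TB hLRne hTBne hwLR hwTB hLRbox hTBbox hLRhead hLRlast hTBhead hTBlast
  rw [hLR, List.mem_cons, List.mem_cons, List.mem_append, List.mem_append, List.mem_reverse] at hvLR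
  rw [hTB, List.mem_append, mem_colWalk_iff, List.mem_cons, List.mem_append, List.mem_append,
    List.mem_reverse, List.mem_cons, mem_colWalk_iff] at hvTB
  have hgood : v ∈ pΓ₁ ∧ v ∈ pP₂ := by
    rcases hvLR with rfl | rfl | hvΓ₁ | hvτ | hvst
    · -- `(-2, h₁)`
      exfalso
      rcases hvTB with ⟨e1, -, -⟩ | e | hv | hv | e | ⟨-, -, e3⟩
      · simp only at e1; omega
      · simp only [Prod.mk.injEq] at e; omega
      · have := hpP₂S _ hv; simp only at this; omega
      · have := hpre₂S _ hv; simp only at this; omega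
      · simp only [Prod.mk.injEq] at e; omega
      · simp only at e3; omega
    · -- `(-1, h₁)`
      exfalso
      rcases hvTB with ⟨e1, -, -⟩ | e | hv | hv | e | ⟨e1, -, -⟩
      · simp only at e1; omega
      · simp only [Prod.mk.injEq] at e; omega
      · have := hpP₂S _ hv; simp only at this; omega
      · have := hpre₂S _ hv; simp only at this; omega
      · simp only [Prod.mk.injEq] at e; omega
      · simp only at e1; omega
    · -- on `Γ̄₁`
      have hb := hpΓ₁S v hvΓ₁
      rcases hvTB with ⟨e1, -, -⟩ | rfl | hv | hv | rfl | ⟨e1, -, -⟩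
      · exfalso; omega
      · exfalso; simp only at hb; omega
      · exact ⟨hvΓ₁, hv⟩
      · -- a column of `Γ`: excluded since `Γ₁ ⊆ R' ∖ 𝒩(Γ, ρ₂)`
        exfalso
        obtain ⟨u, hu, hvu⟩ := List.mem_map.1 hvΓ₁
        obtain ⟨u', hu', hvu'⟩ := List.mem_map.1 hv
        refine (hΓ₁R u hu).2 ⟨u', hmem2 u' hu', ?_⟩
        rw [hvu, ← hvu']
        exact mem_sqBox_self _ _
      · exfalso; simp only at hb; omega
      · exfalso; omega
    · -- on the mirror prefix `τΓ`
      exfalso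
      have hb := hτpre₁S v hvτ
      rcases hvTB with ⟨e1, -, -⟩ | rfl | hv | hv | rfl | ⟨e1, -, -⟩
      · omega
      · simp only at hb; omega
      · -- `P₂ ⊆ τ(R' ∖ 𝒩(Γ, ρ₂))` avoids `τΓ̄`
        obtain ⟨q, hq, hvq⟩ := List.mem_map.1 hv
        obtain ⟨w, -, hwN, hqw⟩ := hP₂R q hq
        obtain ⟨u₀, hu₀, hvu₀⟩ := List.mem_map.1 hvτ
        obtain ⟨u, hu, rfl⟩ := List.mem_map.1 hu₀
        have hwu : w = planar k u := by
          have : τ w = τ (planar k u) := by rw [← hqw, hvq, ← hvu₀]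
          simpa [hτinvol] using congrArg τ this
        exact hwN ⟨u, hmem1 u hu, by rw [hwu]; exact mem_sqBox_self _ _⟩
      · -- `τΓ ∩ Γ`: only on the column `x = 7n`, i.e. at the last vertex of `Γ`
        have hb' := hpre₂S v hv
        obtain ⟨u₀, hu₀, hvu₀⟩ := List.mem_map.1 hvτ
        obtain ⟨u, hu, rfl⟩ := List.mem_map.1 hu₀
        obtain ⟨u', hu', hvu'⟩ := List.mem_map.1 hv
        have hux : (planar k u).1 = 7 * n := by
          have := hpre₁S _ (List.mem_map.2 ⟨u, hu, rfl⟩)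
          rw [hτ, planarReflect_apply] at hvu₀
          rw [← hvu₀] at hb'
          simp only at hb'
          omega
        have hul : u = Γ.getLast hΓO.ne_nil := hlastB u (hmem1 u hu) hux
        have hs : s = [] := hlast1 (hul ▸ hu)
        -- then `g` is the last vertex of `Γ` and `Γ₁` ends on a column of `Γ`
        have hgl : g = Γ.getLast hΓO.ne_nil := by
          subst hs
          rw [List.getLast_congr _ (by simp) hps]; simp
        apply ht₁N
        refine ⟨g, hg, ?_⟩
        rw [ht₁, hτ, planarReflect_apply]
        have hg7 : (planar k g).1 = 7 * n := by rw [hgl, ← hul]; exact hux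
        have : ((14 : ℤ) * n - (planar k g).1, (planar k g).2) = planar k g := by
          ext <;> simp; omega
        rw [this]
        exact mem_sqBox_self _ _
      · simp only at hb; omega
      · omega
    · -- right stubs
      exfalso
      simp only [List.mem_cons, List.not_mem_nil, or_false] at hvst
      rcases hvst with rfl | rfl
      · rcases hvTB with ⟨e0, -, -⟩ | e | hv | hv | e | ⟨e1, -, -⟩
        · simp only at e0; omega
        · simp only [Prod.mk.injEq] at e; omega
        · have := hpP₂S _ hv; simp only at this; omega
        · have := hpre₂S _ hv; simp only at this; omega
        · simp only [Prod.mk.injEq] at e; omega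
        · simp only at e1; omega
      · rcases hvTB with ⟨-, e2, -⟩ | e | hv | hv | e | ⟨e1, -, -⟩
        · simp only at e2; omega
        · simp only [Prod.mk.injEq] at e; omega
        · have := hpP₂S _ hv; simp only at this; omega
        · have := hpre₂S _ hv; simp only at this; omega
        · simp only [Prod.mk.injEq] at e; omega
        · simp only at e1; omega
  -- conclusion: `P₂` reaches a column of `Γ₁`
  obtain ⟨hvΓ₁, hvP₂⟩ := hgood
  obtain ⟨g₁, hg₁, hvg₁⟩ := List.mem_map.1 hvΓ₁
  obtain ⟨q, hq, hvq⟩ := List.mem_map.1 hvP₂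
  obtain ⟨pq, sq, hpq⟩ := List.append_of_mem hq
  have hsub : ∀ x ∈ pq ++ [q], x ∈ slabLift k Q₁.R := by
    intro x hx
    have hxP : x ∈ P₂ := by
      rw [hpq]
      rcases List.mem_append.1 hx with hx | hx
      · exact List.mem_append_left _ hx
      · rw [List.mem_singleton] at hx; subst hx; simp
    obtain ⟨w, hwR, -, hxw⟩ := hP₂R x hxP
    show planar k x ∈ E.R
    rw [hxw, show E.R = boxR 0 (14 * n) 0 (13 * n - 1) from rfl, ← image_reflect14_R n]
    exact Set.mem_image_of_mem _ hwR
  have hchain : (pq ++ [q]).IsChain (fun a b => s(a, b) ∈ ω' ∧ a ≠ b) := by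
    have hc := hP₂.chain
    rw [hpq, ← List.singleton_append, ← List.append_assoc] at hc
    exact (List.isChain_append.1 hc).1
  obtain ⟨a, l, hal⟩ := List.exists_cons_of_ne_nil (show pq ++ [q] ≠ [] by simp)
  have hahd : a = P₂.head hP₂.ne_nil := by
    have : P₂ = (a :: l) ++ sq := by rw [hpq, ← hal]; simp
    symm
    rw [List.head_eq_iff_head?_eq_some, this]; simp
  have hlast : (a :: l).getLast (List.cons_ne_nil a l) = q := by
    rw [List.getLast_congr _ (by simp) hal.symm]; simp
  have hconn : ω' ∈ openConnIn (slabLift k Q₁.R) (P₂.head hP₂.ne_nil) q := by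
    rw [← hahd, ← hlast]
    rw [hal] at hchain hsub
    exact openConnIn_of_isChain a l hchain hsub
  refine ⟨P₂.head hP₂.ne_nil, ?_, q, hconn, g₁, hg₁, ?_⟩
  · show planar k (P₂.head hP₂.ne_nil) ∈ τ '' E.C
    exact hP₂.head_mem hP₂.ne_nil
  · rw [hvq, ← hvg₁]; exact mem_sqBox_self _ _

end Cross

end NTW17

end Literature.Probability.Percolation
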